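import Summits.SmoothPoincare4.SmoothPoincare4.Theorems.EntropyRungConicalGapSelfSimilarEntropy
import Literature.Geometry.Riemannian.ShrinkerEntropyAllScales
import Mathlib.Analysis.SpecialFunctions.Log.Basic
import HarnessLib

/-!
# The cone fence `Θ ≤ a·e^ρ` for complete 4-d shrinkers, modulo Li–Wang's optimal log-Sobolev constant
# (line `Sketch` of crux `EntropyRung.ConicalGap`, stmt-SmoothPoincare4-16589; lead seat c2, cycle 2)

The self-similar test function `ψ_τ = f/τ + log h(τ)` (`h(τ) = (16π²τ²)⁻¹ ∫ e^{-f/τ} dV`) of the sibling file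
`EntropyRungConicalGapSelfSimilarEntropy.lean` has `𝒲(g, ψ_τ, τ) = ((τ − 1)²/τ)⟨R⟩_τ + log h(τ)`
(`wEntropy_selfSimilar`). Li–Wang 2020 (Calc. Var. PDE 59, Thm. 1.1 / Prop. 5.9: "`ν(g) := inf_{τ>0} μ(g, τ)
= μ = μ(g, 1)`", the optimal logarithmic Sobolev constant of a Ricci shrinker is `μ = log Θ` at ALL scales)
turns the left side into an upper bound for the Gaussian density: for every `τ > 0`

  `log Θ ≤ ((τ − 1)²/τ) ⟨R⟩_τ + log h(τ)`,  `Θ = (4π)⁻² ∫ e^{-f} dV`   (`helper_logDensity_le_selfSimilar`),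

and letting `τ → ∞` along the regularised asymptotic volume ratio `h(τ) → a` of the line's skeleton
(`stub_transformLimit`) and the CONE EXCESS `τ⟨R⟩_τ → ρ` (on an asymptotically conical shrinker
`ρ = (R̄_link − 6)/4`, the mean excess scalar curvature of the link; card `avr-density-transform` §(2)):

  `∫ e^{-f} dV ≤ 16π² · a · e^ρ`,  i.e.  `Θ ≤ AVR · e^ρ`   (`helper_density_le_avr_mul_exp`).

Together with the line's identity `Θ = a + (16π²)⁻¹∫ R k(f) dV > a` (p128084, p128759) the density of a
complete non-flat 4-d shrinker with a cone at infinity is PINNED between `a` and `a·e^ρ`; in particular the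
crux `ConicalGap` holds for every shrinker of its class with `16π² a e^ρ ≤ 32π²√π e^{-3/2}`
(`helper_conicalGap_of_coneFence`: thin or almost scalar-flat-excess cones carry no counterexample).

The Li–Wang theorem is the NAMED FACT `Literature.Geometry.Riemannian.LiWang2020_shrinkerLSI_allScales`
(`ShrinkerEntropyAllScales.lean`, D-0014; its proof needs the heat kernel of the shrinker space-time, Li–Wang
§§2–5, absent from the tree), stated in the shape of `CarrilloNi2009_shrinkerLSI` clause (ii) (its case `τ = 1`)
— so every result of this file is CONDITIONAL on it (hypothesis `hLW`) and says so. Nothing else is assumed;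
no definition and no named fact is introduced here.

## References

* [LiWang2020] Y. Li, B. Wang, *Heat kernel on Ricci shrinkers*, Calc. Var. PDE 59 (2020) no. 194 =
  arXiv:1901.05691: Thm. 1.1, §4 (4.3)–(4.4) (definition of `μ(g, τ)` over `W^{1,2}_*`), Prop. 5.9,
  Lemma 5.10 (READ, pp. 3, 14, 18–20 of the arXiv text).
* [CarrilloNi2009] J. Carrillo, L. Ni, Comm. Anal. Geom. 17 (2009) 721–753, Thm. 1.1, §4 (the case `τ = 1`).
* [HaslhoferMuller2011] R. Haslhofer, R. Müller, GAFA 21 (2011), Lemma 2.1 (quadratic growth of `f`; in tree).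
* Y. Wang, G. Wang, arXiv:2308.06560 (2023), Prop. 2.6 (`h(τ)`, `a`).
-/

noncomputable section

-- `Summit.SmoothPoincare4.SmoothPoincare4.…` (summit = problem) trips `dupNamespace` on every decl.
set_option linter.dupNamespace false

open scoped Manifold ContDiff ENNReal NNReal Topology
open MeasureTheory Set Filter
open Literature.Geometry.Lorentzian Literature.Geometry.Riemannian

namespace Summit.SmoothPoincare4.SmoothPoincare4.Theorems.ConicalGapSketch

/-! ## The quadratic growth of the potential gives the second moment of the self-similar density -/

section Growth

variable {M : Type} [TopologicalSpace M] [T2Space M] [SecondCountableTopology M]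
  [ChartedSpace (EuclideanSpace ℝ (Fin 4)) M] [IsManifold (𝓡 4) ∞ M] [ConnectedSpace M]
  [T3Space M] [MeasurableSpace M] [BorelSpace M]

/-- **`d(p, x)² ≤ 8 f(x) + 800` from a minimum point `p` of `f`** on a complete connected normalised 4-d
shrinker: Haslhofer–Müller's lower bound `¼ (d(p,x) − 20)₊² ≤ f(x)` (Lemma 2.1, in the tree:
`HaslhoferMuller.potential_lower_of_scalarCurvature_nonneg`) and `(s + 20)² ≤ 2s² + 800`. -/
theorem coneFence_edist_sq_le
    (g : PseudoRiemannianMetric (𝓡 4) ∞ (EuclideanSpace ℝ (Fin 4)) (TangentSpace (𝓡 4) : M → Type _))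
    [g.HasLeviCivita] (f : M → ℝ) (hg : g.IsRiemannian)
    (hc : ∀ (x : M) (r : NNReal), IsCompact {y : M | g.edist hg x y ≤ r})
    (hf : ContMDiff (𝓡 4) 𝓘(ℝ, ℝ) ∞ f)
    (hsol : ∀ (x : M) (X Y : TangentSpace (𝓡 4) x),
      g.ricci x X Y + g.hessian f x X Y = (1 / 2 : ℝ) * g.val x X Y)
    (hnorm : ∀ x : M, g.scalarCurvature x + g.gradSq f x = f x) :
    ∃ p : M, ∀ x : M, (g.edist hg p x).toReal ^ 2 ≤ 8 * f x + 800 := by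
  classical
  have hS0 : ∀ x, 0 ≤ g.scalarCurvature x :=
    shrinkerScalarCurvature_nonneg_holds 4 M g f hg hc hf hsol hnorm
  have hk1 : ((1 : ℕ∞) : ℕ∞ω) + 1 ≤ (∞ : ℕ∞ω) := by
    rw [show ((1 : ℕ∞) : ℕ∞ω) + 1 = 2 by norm_num]
    exact WithTop.coe_le_coe.2 le_top
  haveI : CovariantDerivative.ContMDiffCovariantDerivative g.leviCivita 1 :=
    ⟨g.isLocallyContMDiff_leviCivita_holds 1 hk1 univ isOpen_univ⟩
  haveI : CovariantDerivative.ContMDiffCovariantDerivative g.leviCivita ∞ :=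
    ⟨g.isLocallyContMDiff_leviCivita_holds ⊤ (le_of_eq rfl) univ isOpen_univ⟩
  have hgrad : ∀ x, g.gradSq f x ≤ f x := fun x ↦ by linarith [hS0 x, hnorm x]
  have hf0 : ∀ x, 0 ≤ f x := fun x ↦ (g.gradSq_nonneg hg f x).trans (hgrad x)
  obtain ⟨p, hp⟩ := HaslhoferMuller.exists_forall_potential_le g hg hc hf hgrad hsol
  refine ⟨p, fun x ↦ ?_⟩
  have hlt : g.edist hg p x < ⊤ := by
    have h := CarrilloNi2009_shrinkerLSI.riemEDist_lt_top (g := g) hg p x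
    rwa [PseudoRiemannianMetric.riemEDist_eq hg] at h
  set r : ℝ≥0 := (g.edist hg p x).toNNReal with hr
  have hrle : (r : ℝ≥0∞) ≤ g.edist hg p x := by rw [hr, ENNReal.coe_toNNReal hlt.ne]
  have hreal : (g.edist hg p x).toReal = (r : ℝ) := by rw [hr, ENNReal.coe_toNNReal_eq_toReal]
  have hlow := HaslhoferMuller.potential_lower_of_scalarCurvature_nonneg g hg hc hf hsol hnorm hS0 hp x r
    hrle
  rw [finrank_euclideanSpace_fin] at hlow
  norm_num at hlow
  rw [hreal]
  have hr0 : 0 ≤ (r : ℝ) := r.2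
  by_cases h20 : (r : ℝ) ≤ 20
  · nlinarith [hf0 x, mul_le_mul h20 h20 hr0 (by norm_num : (0 : ℝ) ≤ 20)]
  · push Not at h20
    rw [max_eq_left (by linarith)] at hlow
    nlinarith [hlow, hf0 x, sq_nonneg ((r : ℝ) - 40)]

end Growth

/-! ## The fence, modulo the fact -/

namespace ConeFence

variable {M : Type} [TopologicalSpace M] [T2Space M] [SecondCountableTopology M]
  [ChartedSpace (EuclideanSpace ℝ (Fin 4)) M] [IsManifold (𝓡 4) ∞ M] [ConnectedSpace M]
  [T3Space M] [MeasurableSpace M] [BorelSpace M]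

/-- `(4π)^{-4/2} = (16π²)⁻¹`. -/
theorem normalisation_one : (4 * Real.pi) ^ (-((4 : ℕ) : ℝ) / 2) = (16 * Real.pi ^ 2)⁻¹ := by
  have h := selfSimilar_normalisation one_pos
  rw [mul_one, one_pow, mul_one] at h
  rw [show ((4 : ℕ) : ℝ) = 4 by norm_num, h]

/-- **`log Θ ≤ 𝒲` of the self-similar test function, modulo Li–Wang** (over `g.riemVolume`): on a
complete connected normalised 4-d shrinker and for `τ > 0`,
`log ((16π²)⁻¹ ∫ e^{-f} dV) ≤ ((τ − 1)²/τ) (∫ R e^{-f/τ})/(∫ e^{-f/τ}) + log ((16π²τ²)⁻¹ ∫ e^{-f/τ} dV)`.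
The three provisos of the fact for `ψ_τ = τ⁻¹ f + log h(τ)` — second moment (`coneFence_edist_sq_le` and
the integrability of `e^{-f/τ}`, `f e^{-f/τ}`), Fisher information (`|∇ψ_τ|² u = τ⁻² (f − R) u`) and the
`𝒲`-integrand (`selfSimilar_integrand`) — are discharged by `stub_weightedIntegrability`.
[cite: LiWang2020, Thm. 1.1 and Prop. 5.9] -/
theorem logDensity_le_selfSimilar (hLW : Literature.Geometry.Riemannian.LiWang2020_shrinkerLSI_allScales)
    (g : PseudoRiemannianMetric (𝓡 4) ∞ (EuclideanSpace ℝ (Fin 4)) (TangentSpace (𝓡 4) : M → Type _))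
    [g.HasLeviCivita] (f : M → ℝ) (hg : g.IsRiemannian)
    (hc : ∀ (x : M) (r : NNReal), IsCompact {y : M | g.edist hg x y ≤ r})
    (hf : ContMDiff (𝓡 4) 𝓘(ℝ, ℝ) ∞ f)
    (hsol : ∀ (x : M) (X Y : TangentSpace (𝓡 4) x),
      g.ricci x X Y + g.hessian f x X Y = (1 / 2 : ℝ) * g.val x X Y)
    (hnorm : ∀ x : M, g.scalarCurvature x + g.gradSq f x = f x) {τ : ℝ} (hτ : 0 < τ) :
    Real.log ((16 * Real.pi ^ 2)⁻¹ * ∫ x, Real.exp (-f x) ∂g.riemVolume) ≤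
      (τ - 1) ^ 2 / τ * ((∫ x, g.scalarCurvature x * Real.exp (-f x / τ) ∂g.riemVolume) /
          (∫ x, Real.exp (-f x / τ) ∂g.riemVolume)) +
        Real.log ((16 * Real.pi ^ 2 * τ ^ 2)⁻¹ * ∫ x, Real.exp (-f x / τ) ∂g.riemVolume) := by
  obtain ⟨hR0, -, hprop⟩ :=
    NoncompactShrinkerGapCarrilloNiClauses.scalarCurvature_nonneg_and_isCompact_sublevel g f hg hc hf
      hsol hnorm
  obtain ⟨hA, hB, hC⟩ := weightedIntegrability_riemVolume hg hf hsol hnorm hprop hR0 hτ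
  have hF := selfSimilar_weight_pos g f hg τ hA
  set F : ℝ := ∫ x, Real.exp (-f x / τ) ∂g.riemVolume with hFdef
  set c : ℝ := Real.log ((16 * Real.pi ^ 2 * τ ^ 2)⁻¹ * F) with hcdef
  set ψ : M → ℝ := fun y ↦ τ⁻¹ * f y + c with hψdef
  have hψs : ContMDiff (𝓡 4) 𝓘(ℝ, ℝ) ∞ ψ := (contMDiff_const.mul hf).add contMDiff_const
  have hcompat : g.IsEntropyCompatible ψ τ := selfSimilar_isEntropyCompatible g f hg hτ hA
  have hdens : ∀ x, entropyDensity 4 ψ τ x = F⁻¹ * Real.exp (-f x / τ) := fun x ↦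
    selfSimilar_entropyDensity f hτ hF x
  have hcont_e : Continuous fun x ↦ Real.exp (-f x / τ) :=
    Real.continuous_exp.comp (hf.continuous.neg.div_const τ)
  -- completeness in the `riemEDist` vocabulary of the fact
  have hc' : ∀ (x : M) (r : NNReal), IsCompact {y : M | g.riemEDist x y ≤ r} := fun x r ↦ by
    simp_rw [PseudoRiemannianMetric.riemEDist_eq hg]
    exact hc x r
  -- (a) second moment
  have hmom : ∃ o : M, Integrable (fun x ↦ (g.riemEDist o x).toReal ^ 2 * entropyDensity 4 ψ τ x)
      g.riemVolume := by
    obtain ⟨p, hp⟩ := coneFence_edist_sq_le g f hg hc hf hsol hnorm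
    refine ⟨p, ?_⟩
    have hmeas : Measurable fun x ↦ (g.edist hg p x).toReal :=
      ENNReal.measurable_toReal.comp
        ((PseudoRiemannianMetric.continuous_edist hg).comp (Continuous.prodMk_right p)).measurable
    have hmaj : Integrable (fun x ↦ (8 * f x + 800) * (F⁻¹ * Real.exp (-f x / τ))) g.riemVolume :=
      (((hB.const_mul 8).add (hA.const_mul 800)).const_mul F⁻¹).congr
        (Eventually.of_forall fun x ↦ by simp only [Pi.add_apply]; ring)
    refine hmaj.mono' ?_ (Eventually.of_forall fun x ↦ ?_)
    · simp_rw [hdens, PseudoRiemannianMetric.riemEDist_eq hg]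
      exact ((hmeas.pow_const 2).mul (hcont_e.measurable.const_mul _)).aestronglyMeasurable
    · rw [hdens, PseudoRiemannianMetric.riemEDist_eq hg, Real.norm_eq_abs, abs_of_nonneg (by positivity)]
      have hu0 : 0 ≤ F⁻¹ * Real.exp (-f x / τ) := by positivity
      exact mul_le_mul_of_nonneg_right (hp x) hu0
  -- (b) Fisher information `|∇ψ|² u = τ⁻² (f − R) F⁻¹ e^{-f/τ}`
  have hfisher : Integrable (fun x ↦ g.gradSq ψ x * entropyDensity 4 ψ τ x) g.riemVolume := by
    refine (((hB.sub hC).const_mul (τ⁻¹ ^ 2 * F⁻¹))).congr (Eventually.of_forall fun x ↦ ?_)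
    simp only [Pi.sub_apply]
    rw [hdens, hψdef, selfSimilar_gradSq τ c (hf.mdifferentiableAt (by norm_num)),
      show g.gradSq f x = f x - g.scalarCurvature x by linarith [hnorm x]]
    ring
  -- (c) the `𝒲`-integrand
  have hWint : Integrable (fun x ↦ (τ * (g.scalarCurvature x + g.gradSq ψ x) + ψ x - (4 : ℕ)) *
      entropyDensity 4 ψ τ x) g.riemVolume := by
    have i1 : Integrable (fun x ↦ F⁻¹ * (τ - τ⁻¹) * (g.scalarCurvature x * Real.exp (-f x / τ)))
        g.riemVolume := hC.const_mul _
    have i2 : Integrable (fun x ↦ F⁻¹ * (2 * τ⁻¹) * (f x * Real.exp (-f x / τ))) g.riemVolume :=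
      hB.const_mul _
    have i3 : Integrable (fun x ↦ F⁻¹ * (c - 4) * Real.exp (-f x / τ)) g.riemVolume := hA.const_mul _
    refine ((i1.add i2).add i3).congr (Eventually.of_forall fun x ↦ ?_)
    simp only [Pi.add_apply]
    rw [hψdef, selfSimilar_integrand hnorm hτ.ne' c (hf.mdifferentiableAt (by norm_num)), hdens,
      show ((4 : ℕ) : ℝ) = 4 by norm_num]
    ring
  have hmain := hLW 4 M g f hg hc' hf hsol hnorm τ hτ ψ hψs hcompat hmom hfisher hWint
  rw [normalisation_one, hψdef, hcdef, wEntropy_selfSimilar g f hg hc hf hsol hnorm hτ] at hmain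
  exact hmain

/-- **The fence at a finite scale, exponentiated**: `∫ e^{-f} dV ≤ τ⁻² ∫ e^{-f/τ} dV · exp(((τ−1)²/τ)⟨R⟩_τ)`
for every `τ > 0`, modulo Li–Wang. [cite: LiWang2020, Thm. 1.1 and Prop. 5.9] -/
theorem integral_exp_neg_le_selfSimilar (hLW : Literature.Geometry.Riemannian.LiWang2020_shrinkerLSI_allScales)
    (g : PseudoRiemannianMetric (𝓡 4) ∞ (EuclideanSpace ℝ (Fin 4)) (TangentSpace (𝓡 4) : M → Type _))
    [g.HasLeviCivita] (f : M → ℝ) (hg : g.IsRiemannian)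
    (hc : ∀ (x : M) (r : NNReal), IsCompact {y : M | g.edist hg x y ≤ r})
    (hf : ContMDiff (𝓡 4) 𝓘(ℝ, ℝ) ∞ f)
    (hsol : ∀ (x : M) (X Y : TangentSpace (𝓡 4) x),
      g.ricci x X Y + g.hessian f x X Y = (1 / 2 : ℝ) * g.val x X Y)
    (hnorm : ∀ x : M, g.scalarCurvature x + g.gradSq f x = f x) {τ : ℝ} (hτ : 0 < τ) :
    ∫ x, Real.exp (-f x) ∂g.riemVolume ≤
      (16 * Real.pi ^ 2) * (((16 * Real.pi ^ 2 * τ ^ 2)⁻¹ * ∫ x, Real.exp (-f x / τ) ∂g.riemVolume) *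
        Real.exp ((τ - 1) ^ 2 / τ * ((∫ x, g.scalarCurvature x * Real.exp (-f x / τ) ∂g.riemVolume) /
          (∫ x, Real.exp (-f x / τ) ∂g.riemVolume)))) := by
  obtain ⟨hR0, -, hprop⟩ :=
    NoncompactShrinkerGapCarrilloNiClauses.scalarCurvature_nonneg_and_isCompact_sublevel g f hg hc hf
      hsol hnorm
  obtain ⟨hA, -, -⟩ := weightedIntegrability_riemVolume hg hf hsol hnorm hprop hR0 hτ
  obtain ⟨hA1, -, -⟩ := weightedIntegrability_riemVolume hg hf hsol hnorm hprop hR0 one_pos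
  have hF := selfSimilar_weight_pos g f hg τ hA
  have hF1 : 0 < ∫ x, Real.exp (-f x) ∂g.riemVolume := by
    have h := selfSimilar_weight_pos g f hg 1 hA1
    simpa only [div_one] using h
  have hlog := logDensity_le_selfSimilar hLW g f hg hc hf hsol hnorm hτ
  set A : ℝ := (τ - 1) ^ 2 / τ * ((∫ x, g.scalarCurvature x * Real.exp (-f x / τ) ∂g.riemVolume) /
    (∫ x, Real.exp (-f x / τ) ∂g.riemVolume)) with hAdef
  set h : ℝ := (16 * Real.pi ^ 2 * τ ^ 2)⁻¹ * ∫ x, Real.exp (-f x / τ) ∂g.riemVolume with hhdef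
  have hh : 0 < h := by positivity
  have hΘ : 0 < (16 * Real.pi ^ 2)⁻¹ * ∫ x, Real.exp (-f x) ∂g.riemVolume := by positivity
  -- exponentiate `log Θ' ≤ A + log h`
  have hexp : (16 * Real.pi ^ 2)⁻¹ * ∫ x, Real.exp (-f x) ∂g.riemVolume ≤ h * Real.exp A := by
    have h1 : Real.log ((16 * Real.pi ^ 2)⁻¹ * ∫ x, Real.exp (-f x) ∂g.riemVolume) ≤
        Real.log (h * Real.exp A) := by
      rw [Real.log_mul hh.ne' (Real.exp_pos A).ne', Real.log_exp]
      linarith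
    exact (Real.log_le_log_iff hΘ (mul_pos hh (Real.exp_pos A))).1 h1
  have h16 : (0 : ℝ) < 16 * Real.pi ^ 2 := by positivity
  calc ∫ x, Real.exp (-f x) ∂g.riemVolume
      = (16 * Real.pi ^ 2) * ((16 * Real.pi ^ 2)⁻¹ * ∫ x, Real.exp (-f x) ∂g.riemVolume) := by
        field_simp
    _ ≤ (16 * Real.pi ^ 2) * (h * Real.exp A) := by gcongr

/-- **The cone fence `∫ e^{-f} dV ≤ 16π² · a · e^ρ`, modulo Li–Wang**: if the regularised asymptotic volume
ratio `h(τ) = (16π²τ²)⁻¹ ∫ e^{-f/τ} dV → a` (the `a` of `stub_transformLimit`) and the cone excess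
`τ ⟨R⟩_τ → ρ` as `τ → ∞`, then `Θ ≤ a e^ρ`. [cite: LiWang2020, Thm. 1.1 and Prop. 5.9] -/
theorem integral_exp_neg_le_avr_mul_exp (hLW : Literature.Geometry.Riemannian.LiWang2020_shrinkerLSI_allScales)
    (g : PseudoRiemannianMetric (𝓡 4) ∞ (EuclideanSpace ℝ (Fin 4)) (TangentSpace (𝓡 4) : M → Type _))
    [g.HasLeviCivita] (f : M → ℝ) (hg : g.IsRiemannian)
    (hc : ∀ (x : M) (r : NNReal), IsCompact {y : M | g.edist hg x y ≤ r})
    (hf : ContMDiff (𝓡 4) 𝓘(ℝ, ℝ) ∞ f)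
    (hsol : ∀ (x : M) (X Y : TangentSpace (𝓡 4) x),
      g.ricci x X Y + g.hessian f x X Y = (1 / 2 : ℝ) * g.val x X Y)
    (hnorm : ∀ x : M, g.scalarCurvature x + g.gradSq f x = f x) {a ρ : ℝ}
    (ha : Tendsto (fun T : ℝ ↦ (16 * Real.pi ^ 2 * T ^ 2)⁻¹ * ∫ x, Real.exp (-f x / T) ∂g.riemVolume)
      atTop (𝓝 a))
    (hρ : Tendsto (fun T : ℝ ↦ T * ((∫ x, g.scalarCurvature x * Real.exp (-f x / T) ∂g.riemVolume) /
      (∫ x, Real.exp (-f x / T) ∂g.riemVolume))) atTop (𝓝 ρ)) :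
    ∫ x, Real.exp (-f x) ∂g.riemVolume ≤ 16 * Real.pi ^ 2 * a * Real.exp ρ := by
  -- the right side of the finite-scale fence tends to `16π² a e^ρ`
  have hcoef : Tendsto (fun T : ℝ ↦ (T - 1) ^ 2 / T ^ 2) atTop (𝓝 1) := by
    have h1 : Tendsto (fun T : ℝ ↦ (1 - T⁻¹) ^ 2) atTop (𝓝 ((1 - 0) ^ 2)) :=
      (tendsto_const_nhds.sub tendsto_inv_atTop_zero).pow 2
    rw [sub_zero, one_pow] at h1
    refine h1.congr' ?_
    filter_upwards [eventually_gt_atTop (0 : ℝ)] with T hT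
    field_simp
  have hexpo : Tendsto (fun T : ℝ ↦ (T - 1) ^ 2 / T *
      ((∫ x, g.scalarCurvature x * Real.exp (-f x / T) ∂g.riemVolume) /
        (∫ x, Real.exp (-f x / T) ∂g.riemVolume))) atTop (𝓝 ρ) := by
    have h := hcoef.mul hρ
    rw [one_mul] at h
    refine h.congr' ?_
    filter_upwards [eventually_gt_atTop (0 : ℝ)] with T hT
    field_simp
  have hlim : Tendsto (fun T : ℝ ↦ (16 * Real.pi ^ 2) *
      (((16 * Real.pi ^ 2 * T ^ 2)⁻¹ * ∫ x, Real.exp (-f x / T) ∂g.riemVolume) *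
        Real.exp ((T - 1) ^ 2 / T * ((∫ x, g.scalarCurvature x * Real.exp (-f x / T) ∂g.riemVolume) /
          (∫ x, Real.exp (-f x / T) ∂g.riemVolume))))) atTop (𝓝 ((16 * Real.pi ^ 2) * (a * Real.exp ρ))) :=
    (ha.mul (Real.continuous_exp.continuousAt.tendsto.comp hexpo)).const_mul _
  rw [← mul_assoc] at hlim
  refine ge_of_tendsto hlim ?_
  filter_upwards [eventually_gt_atTop (0 : ℝ)] with T hT
  exact integral_exp_neg_le_selfSimilar hLW g f hg hc hf hsol hnorm hT

end ConeFence

/-! ## Registered helpers (crux vocabulary) -/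

/-- **Helper `helper_logDensity_le_selfSimilar` of line `Sketch`** (crux `EntropyRung.ConicalGap`; CONDITIONAL
on the named fact `LiWang2020_shrinkerLSI_allScales`): on every complete connected normalised 4-d gradient
shrinking Ricci soliton and for every `τ > 0`, the Gaussian density is bounded through the self-similar test
function: `log ((16π²)⁻¹ ∫ e^{-f} dV) ≤ ((τ − 1)²/τ)·(∫ R e^{-f/τ} dV)/(∫ e^{-f/τ} dV) + log ((16π²τ²)⁻¹ ∫ e^{-f/τ} dV)`
(`dV` the Riemannian measure of `g.toContMDiffRiemannianMetric hg`). Equality at `τ = 1`; as `τ → ∞` the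
right side is `log a + ρ` on an asymptotically conical shrinker. [cite: LiWang2020, Thm. 1.1 and Prop. 5.9] -/
theorem helper_logDensity_le_selfSimilar : Literature.Geometry.Riemannian.LiWang2020_shrinkerLSI_allScales → ∀ (M : Type) [TopologicalSpace M] [T2Space M] [SecondCountableTopology M] [ChartedSpace (EuclideanSpace ℝ (Fin 4)) M] [IsManifold (𝓡 4) ∞ M] [ConnectedSpace M] [T3Space M] [MeasurableSpace M] [BorelSpace M] (g : Literature.Geometry.Lorentzian.PseudoRiemannianMetric (𝓡 4) ∞ (EuclideanSpace ℝ (Fin 4)) (TangentSpace (𝓡 4) : M → Type _)) [g.HasLeviCivita] (f : M → ℝ) (hg : g.IsRiemannian), (∀ (x : M) (r : NNReal), IsCompact {y : M | g.edist hg x y ≤ r}) → ContMDiff (𝓡 4) 𝓘(ℝ, ℝ) ∞ f → (∀ (x : M) (X Y : TangentSpace (𝓡 4) x), g.ricci x X Y + g.hessian f x X Y = (1 / 2 : ℝ) * g.val x X Y) → (∀ x : M, g.scalarCurvature x + g.gradSq f x = f x) → ∀ τ : ℝ, 0 < τ → Real.log ((16 * Real.pi ^ 2)⁻¹ * ∫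 x, Real.exp (-f x) ∂(Literature.Geometry.Lorentzian.riemannianMeasure (g.toContMDiffRiemannianMetric hg))) ≤ (τ - 1) ^ 2 / τ * ((∫ x, g.scalarCurvature x * Real.exp (-f x / τ) ∂(Literature.Geometry.Lorentzian.riemannianMeasure (g.toContMDiffRiemannianMetric hg))) / (∫ x, Real.exp (-f x / τ) ∂(Literature.Geometry.Lorentzian.riemannianMeasure (g.toContMDiffRiemannianMetric hg)))) + Real.log ((16 * Real.pi ^ 2 * τ ^ 2)⁻¹ * ∫ x, Real.exp (-f x / τ) ∂(Literature.Geometry.Lorentzian.riemannianMeasure (g.toContMDiffRiemannianMetric hg))) := by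
  intro hLW M _ _ _ _ _ _ _ _ _ g _ f hg hc hf hsol hnorm τ hτ
  rw [← PseudoRiemannianMetric.riemVolume_eq hg]
  exact ConeFence.logDensity_le_selfSimilar hLW g f hg hc hf hsol hnorm hτ

/-- **Helper `helper_density_le_avr_mul_exp` of line `Sketch` — the CONE FENCE** (CONDITIONAL on
`LiWang2020_shrinkerLSI_allScales`): on every complete connected normalised 4-d gradient shrinker, if the
regularised asymptotic volume ratio `h(T) = (16π²T²)⁻¹ ∫ e^{-f/T} dV → a` (the `a` of the line's identity
`∫ e^{-f} = 16π² a + ∫ R k(f)`, `stub_transformLimit`) and the cone excess `T⟨R⟩_T → ρ` as `T → ∞`, then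
`∫ e^{-f} dV ≤ 16π² · a · e^ρ`, i.e. `Θ ≤ AVR · e^ρ`; on an asymptotically conical shrinker `ρ = (R̄_h − 6)/4`,
the mean excess scalar curvature of the link `(N, h)` of the asymptotic cone. With `a < Θ` (p128759) the density
is pinned to `(a, a e^ρ]`. [cite: LiWang2020, Thm. 1.1 and Prop. 5.9] -/
theorem helper_density_le_avr_mul_exp : Literature.Geometry.Riemannian.LiWang2020_shrinkerLSI_allScales → ∀ (M : Type) [TopologicalSpace M] [T2Space M] [SecondCountableTopology M] [ChartedSpace (EuclideanSpace ℝ (Fin 4)) M] [IsManifold (𝓡 4) ∞ M] [ConnectedSpace M] [T3Space M] [MeasurableSpace M] [BorelSpace M] (g : Literature.Geometry.Lorentzian.PseudoRiemannianMetric (𝓡 4) ∞ (EuclideanSpace ℝ (Fin 4)) (TangentSpace (𝓡 4) : M → Type _)) [g.HasLeviCivita] (f : M → ℝ) (hg : g.IsRiemannian), (∀ (x : M) (r : NNReal), IsCompact {y : M | g.edist hg x y ≤ r}) → ContMDiff (𝓡 4) 𝓘(ℝ, ℝ) ∞ f → (∀ (x : M) (X Y : TangentSpace (𝓡 4) x),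 g.ricci x X Y + g.hessian f x X Y = (1 / 2 : ℝ) * g.val x X Y) → (∀ x : M, g.scalarCurvature x + g.gradSq f x = f x) → ∀ a ρ : ℝ, Filter.Tendsto (fun T : ℝ ↦ (16 * Real.pi ^ 2 * T ^ 2)⁻¹ * ∫ x, Real.exp (-f x / T) ∂(Literature.Geometry.Lorentzian.riemannianMeasure (g.toContMDiffRiemannianMetric hg))) Filter.atTop (nhds a) → Filter.Tendsto (fun T : ℝ ↦ T * ((∫ x, g.scalarCurvature x * Real.exp (-f x / T) ∂(Literature.Geometry.Lorentzian.riemannianMeasure (g.toContMDiffRiemannianMetric hg))) / (∫ x, Real.exp (-f x / T) ∂(Literature.Geometry.Lorentzian.riemannianMeasure (g.toContMDiffRiemannianMetric hg))))) Filter.atTop (nhds ρ) → ∫ x, Real.exp (-f x) ∂(Literature.Geometry.Lorentzian.riemannianMeasure (g.toContMDiffRiemannianMetric hg)) ≤ 16 * Real.pi ^ 2 * a * Real.exp ρ := by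
  intro hLW M _ _ _ _ _ _ _ _ _ g _ f hg hc hf hsol hnorm a ρ ha hρ
  rw [← PseudoRiemannianMetric.riemVolume_eq hg] at ha hρ ⊢
  exact ConeFence.integral_exp_neg_le_avr_mul_exp hLW g f hg hc hf hsol hnorm ha hρ

/-- **Helper `helper_conicalGap_of_coneFence` of line `Sketch` — the crux on the THIN-CONE / SMALL-EXCESS
sub-class** (CONDITIONAL on `LiWang2020_shrinkerLSI_allScales`): a shrinker of the crux class (complete connected
non-compact non-flat normalised 4-d gradient shrinker with `R → 0` at infinity) whose regularised AVR `a` and cone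
excess `ρ` satisfy `16π² a e^ρ ≤ 32π²√π e^{-3/2}` (i.e. `AVR · e^{(R̄_h−6)/4} ≤ Θ(S³×ℝ) = .791`) satisfies the
conclusion of `EntropyRung.ConicalGap`. (Non-flatness, non-compactness and the decay clause are not used: the
fence needs only completeness.) [cite: LiWang2020, Thm. 1.1 and Prop. 5.9] -/
theorem helper_conicalGap_of_coneFence : Literature.Geometry.Riemannian.LiWang2020_shrinkerLSI_allScales → ∀ (M : Type) [TopologicalSpace M] [T2Space M] [SecondCountableTopology M] [ChartedSpace (EuclideanSpace ℝ (Fin 4)) M] [IsManifold (𝓡 4) ∞ M] [ConnectedSpace M] [NoncompactSpace M] [T3Space M] [MeasurableSpace M] [BorelSpace M] (g : Literature.Geometry.Lorentzian.PseudoRiemannianMetric (𝓡 4) ∞ (EuclideanSpace ℝ (Fin 4)) (TangentSpace (𝓡 4) : M → Type _)) [g.HasLeviCivita] (f : M → ℝ) (hg : g.IsRiemannian), (∀ (x : M) (r : NNReal), IsCompact {y : M | g.edist hg x y ≤ r}) → ContMDiff (𝓡 4) 𝓘(ℝ, ℝ) ∞ f → (∀ (x : M) (X Y : TangentSpace (𝓡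 4) x), g.ricci x X Y + g.hessian f x X Y = (1 / 2 : ℝ) * g.val x X Y) → (∀ x : M, g.scalarCurvature x + g.gradSq f x = f x) → (∃ x : M, g.scalarCurvature x ≠ 0) → (∀ ε : ℝ, 0 < ε → ∃ K : Set M, IsCompact K ∧ ∀ x, x ∉ K → g.scalarCurvature x < ε) → ∀ a ρ : ℝ, Filter.Tendsto (fun T : ℝ ↦ (16 * Real.pi ^ 2 * T ^ 2)⁻¹ * ∫ x, Real.exp (-f x / T) ∂(Literature.Geometry.Lorentzian.riemannianMeasure (g.toContMDiffRiemannianMetric hg))) Filter.atTop (nhds a) → Filter.Tendsto (fun T : ℝ ↦ T * ((∫ x, g.scalarCurvature x * Real.exp (-f x / T) ∂(Literature.Geometry.Lorentzian.riemannianMeasure (g.toContMDiffRiemannianMetric hg))) / (∫ x, Real.exp (-f x / T) ∂(Literature.Geometry.Lorentzian.riemannianMeasure (g.toContMDiffRiemannianMetric hg))))) Filter.atTop (nhds ρ) → 16 * Real.pi ^ 2 * a * Real.exp ρ ≤ 32 * Real.pi ^ 2 * Real.sqrt Real.pi * Real.exp (-(3 : ℝ) / 2) → ∫⁻ x, ENNReal.ofReal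 (Real.exp (-f x)) ∂(Literature.Geometry.Lorentzian.riemannianMeasure (g.toContMDiffRiemannianMetric hg)) ≤ ENNReal.ofReal (32 * Real.pi ^ 2 * Real.sqrt Real.pi * Real.exp (-(3 : ℝ) / 2)) := by
  intro hLW M _ _ _ _ _ _ _ _ _ _ g _ f hg hc hf hsol hnorm _ _ a ρ ha hρ hbudget
  have hfence := helper_density_le_avr_mul_exp hLW M g f hg hc hf hsol hnorm a ρ ha hρ
  obtain ⟨hI1, -, -⟩ := stub_weightedIntegrability M g f hg hc hf hsol hnorm 1 one_pos
  have hI1' : Integrable (fun x ↦ Real.exp (-f x))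
      (riemannianMeasure (g.toContMDiffRiemannianMetric hg)) := by
    simpa only [div_one] using hI1
  rw [← ofReal_integral_eq_lintegral_ofReal hI1' (ae_of_all _ fun x ↦ (Real.exp_pos _).le)]
  exact ENNReal.ofReal_le_ofReal (hfence.trans hbudget)

end Summit.SmoothPoincare4.SmoothPoincare4.Theorems.ConicalGapSketch

end
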